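import Literature.AlgebraicGeometry.Motives.QuadricsFiniteFieldCohomology
import Literature.AlgebraicGeometry.Motives.ZetaFunctionConstantFieldExtensionPoleOrder
import HarnessLib

/-!
# The elliptic quadric `ℰ_{2l+3}` over ALL constant field extensions `𝔽_{q^m}`:
# `Z(ℰ ⊗ 𝔽_{q^m}, T) = 1/(∏_{i≤2l+2}(1 − q^{mi}T) · (1 − (−q^{l+1})^m T))` — the middle pole at `(q^m)^{−(l+1)}` is
# DOUBLE for `m` even and SIMPLE for `m` odd; in cohomology `φ_{l+1}^m = 1` (`m` even) resp. `= φ_{l+1}` (`m` odd):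
# the second ruling is rational exactly over the even-degree extensions

Topic `Literature/AlgebraicGeometry/Motives`; THEOREMS ONLY (no definition, no instance, no named fact; D-0026).
Sequel to g51-#11 (`Motives/EllipticQuadricPointCount`: `#ℰ(𝔽_{q^m}) = Σ_{i≤2l+2} q^{mi} + (−q^{l+1})^m`, the case
`m = 2`: `Z(ℰ ⊗ 𝔽_{q²}) = Z(ℋ ⊗ 𝔽_{q²})`, double middle pole) and g52-#3 (`Motives/QuadricsFiniteFieldCohomology`:
`F² = q^{2l+2}`, `φ_{l+1}² = 1 ≠ φ_{l+1}` on `H^{2l+2}(ℰ)(l+1)`).  For every `m ≥ 1`: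

* §1 (E-free, Dwork's `countZeta`): **`zetaSeriesPow_ellipticQuadric_mul_prod`**
  (`Z(ℰ ⊗ 𝔽_{q^m}, T)·∏_{i≤2l+2}(1 − (q^m)ⁱT)·(1 − (−q^{l+1})^m T) = 1`, Stichtenoth Thm. 5.1.15 (f): the inverse roots of
  `Z_m` are the `m`-th powers), `…_of_even` (the extra factor is `1 − (q^m)^{l+1}T`), `…_of_odd` (`1 + (q^m)^{l+1}T`);
  **`hasPoleOfOrderAt_zetaSeriesPow_ellipticQuadric_middle_of_even`** (order EXACTLY `2` at `(q^m)^{−(l+1)}`),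
  **`…_middle_of_odd`** (order EXACTLY `1`), `…_of_ne` (order `1` off the middle, all `m`), and the parity form
  **`hasPoleOfOrderAt_zetaSeriesPow_ellipticQuadric_middle`** (order `if Even m then 2 else 1`).
* §2 (`E` with the trace formula, `χ(φ) = q`, `ε` a non-square, RH for `ℰ`): **`ρTwist_pow_ellipticQuadric_middle_of_even`**
  (`φ_{l+1}(Fᵐ) = 1` on `H^{2l+2}(ℰ)(l+1)` for `m` even: ALL middle classes are fixed by the Frobenius of `𝔽_{q^m}`),
  **`ρTwist_pow_ellipticQuadric_middle_of_odd`** (`φ_{l+1}(Fᵐ) = φ_{l+1}` for `m` odd),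
  **`ker_ρTwist_pow_sub_one_ellipticQuadric_middle`** (`…_of_even`: `Ker(φ_{l+1}(Fᵐ) − 1) = ⊤`; `…_of_odd`:
  `= K·η^{l+1}` — the class of the second ruling is rational over `𝔽_{q^m}` EXACTLY when `m` is even),
  `finrank_ker_ρTwist_pow_sub_one_ellipticQuadric_middle` (`2` resp. `1`),
  **`finrank_maxGenEigenspace_ρTwist_pow_ellipticQuadric_middle`** (`dim H^{2l+2}(ℰ)(l+1)_{(φᵐ),1} = 2` resp. `1` — the
  pole orders of §1 read through the tree's `hasPoleOfOrderAt_zetaSeriesPow`), and off the middle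
  `ρTwist_pow_ellipticQuadric_eq_one_of_ne` (`φ_r(Fᵐ) = 1` on the line `H^{2r}(ℰ)`, `r ≠ l+1`).

HC is not touched.

## References

* [Stichtenoth2009] H. Stichtenoth, Algebraic Function Fields and Codes, 2nd ed. (2009), Thm. 5.1.15 (f) (`Z_r(t)` over
  the constant field extension of degree `r`).
* [Hirschfeld1998] J. W. P. Hirschfeld, Projective Geometries over Finite Fields (1998), §5.2 Thm. 5.2.6 (ii)–(iii).
* [Kahn2020] B. Kahn, Zeta and L-Functions of Varieties and Motives (2020), §3.6 Remark 3.66; §6.14 Conj. 6.52.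
* [TateWoodsHole1965] J. Tate, Algebraic cycles and poles of zeta functions (1965), §3.
* [Tate1994] J. Tate, Conjectures on algebraic cycles in ℓ-adic cohomology, PSPM 55.1 (1994), §1.
* [Weil1949] A. Weil, Bull. AMS 55 (1949), p. 507.
* [LidlNiederreiter1996] R. Lidl, H. Niederreiter, Finite Fields (1996), Thm. 2.6 (subfields `𝔽_{q^m}`).
* Tree: `Motives/EllipticQuadricPointCount` (g51-#11), `Motives/QuadricsFiniteFieldCohomology` (g52-#3),
  `Motives/SimplePoleTateConjecture` (g52-#2), `Motives/ZetaFunctionConstantFieldExtensionPoleOrder`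
  (`hasPoleOfOrderAt_zetaSeriesPow`), `Motives/ClosedPointsConstantFieldExtension` (`zetaSeriesPow_eq_countZeta`),
  `NumberTheory/LFunctions/DworkRationality` (`countZeta_pow_mul`), `Kahn2003/RationalNumericalEquivalenceOfTate`
  (`HasPoleOfOrderAt`, `.unique`, `hasPoleOfOrderAt_of_mul_prod_pow_eq_one`).

## Provenance

Lane `lit-hodgefound` (summit `HodgeConjecture`, Track 2 foundations library, Layer B: motives ∕ varieties over finite
fields), seat `lit-hodgefound-p29` (literature-prover, generation 52, row g52-#6).
-/

universe u v

open Polynomial Finset CategoryTheory AlgebraicGeometry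
open Literature.NumberTheory.LFunctions.Dwork (countZeta countZeta_congr countZeta_pow_mul countZeta_sum countZeta_add)
open Literature.AlgebraicGeometry.Kahn2003 (HasPoleOfOrderAt hasPoleOfOrderAt_of_mul_prod_pow_eq_one)

noncomputable section

namespace Literature.AlgebraicGeometry.Motives

/-! ### §1 `Z(ℰ ⊗ 𝔽_{q^m}, T)` for every `m ≥ 1` and its pole orders -/

section EFree

open SmoothHypersurface (hypersurface)

variable {k : Type u} [Field k] [Finite k] (l : ℕ) {ε : k}

/-- `l + 1 ≤ 2l + 2 + 2` (any proof matches the tree's by proof irrelevance). [folklore] -/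
private theorem leE (l : ℕ) : l + 1 ≤ 2 * l + 2 + 2 := by omega

/-- The middle coordinate `l + 1`. [folklore] -/
private theorem ltE₁ (l : ℕ) : l + 1 < 2 * l + 2 + 2 := by omega

/-- The middle coordinate `l + 2`. [folklore] -/
private theorem ltE₂ (l : ℕ) : l + 2 < 2 * l + 2 + 2 := by omega

/-- **`Z(ℰ ⊗ 𝔽_{q^m}, T) · ∏_{i=0}^{2l+2} (1 − (q^m)ⁱT) · (1 − (−q^{l+1})^m T) = 1`** for every `m ≥ 1`: over `𝔽_{q^m}` the
inverse roots of the zeta function are the `m`-th powers `q^{mi}` (`i ≤ 2l+2`) and `(−q^{l+1})^m` (Dwork's `countZeta`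
of the counts `#ℰ(𝔽_{q^{ms}}) = Σ q^{msi} + (−q^{l+1})^{ms}`). [cite: Stichtenoth2009, Theorem 5.1.15 (f)]
[cite: Hirschfeld1998, §5.2 Thm. 5.2.6 (ii), (iii)] [cite: Weil1949, p. 507] -/
theorem zetaSeriesPow_ellipticQuadric_mul_prod (hε : ¬IsSquare ε) {m : ℕ} (hm : 0 < m) :
    zetaSeriesPow
        (hypersurface ((∑ i : Fin (l + 1), MvPolynomial.X (Fin.castLE (leE l) i) *
          MvPolynomial.X (Fin.rev (Fin.castLE (leE l) i))) + MvPolynomial.X (Fin.mk (l + 1) (ltE₁ l)) ^ 2 -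
          MvPolynomial.C ε * MvPolynomial.X (Fin.mk (l + 2) (ltE₂ l)) ^ 2 : MvPolynomial (Fin (2 * l + 2 + 2)) k)) m *
      ((∏ i ∈ range (2 * l + 3), ((1 - C (((Nat.card k : ℚ) ^ m) ^ i) * X : ℚ[X]) : PowerSeries ℚ)) *
        ((1 - C ((-((Nat.card k : ℚ) ^ (l + 1))) ^ m) * X : ℚ[X]) : PowerSeries ℚ)) = 1 := by
  have hZ : zetaSeriesPow
        (hypersurface ((∑ i : Fin (l + 1), MvPolynomial.X (Fin.castLE (leE l) i) *
          MvPolynomial.X (Fin.rev (Fin.castLE (leE l) i))) + MvPolynomial.X (Fin.mk (l + 1) (ltE₁ l)) ^ 2 -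
          MvPolynomial.C ε * MvPolynomial.X (Fin.mk (l + 2) (ltE₂ l)) ^ 2 : MvPolynomial (Fin (2 * l + 2 + 2)) k)) m =
      (∏ i ∈ range (2 * l + 3), countZeta (fun s => (((Nat.card k : ℤ) ^ m) ^ i) ^ s)) *
        countZeta (fun s => ((-(Nat.card k : ℤ) ^ (l + 1)) ^ m) ^ s) := by
    rw [zetaSeriesPow_eq_countZeta, ← countZeta_sum, ← countZeta_add]
    refine countZeta_congr fun s hs => ?_
    rw [pointCount_ellipticQuadric_cast l hε (Nat.mul_pos hm hs), Pi.add_apply, Finset.sum_apply]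
    congr 1
    · exact Finset.sum_congr rfl fun i _ => by rw [← pow_mul, ← pow_mul, ← pow_mul]; ring_nf
    · rw [← pow_mul]
  have hc : ∀ a : ℤ, countZeta (fun s => a ^ s) * ((1 - C (a : ℚ) * X : ℚ[X]) : PowerSeries ℚ) = 1 :=
    fun a => countZeta_pow_mul a
  have hc₁ : ∀ i : ℕ, countZeta (fun s => (((Nat.card k : ℤ) ^ m) ^ i) ^ s) *
      ((1 - C (((Nat.card k : ℚ) ^ m) ^ i) * X : ℚ[X]) : PowerSeries ℚ) = 1 := by
    intro i
    have h := hc (((Nat.card k : ℤ) ^ m) ^ i)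
    rw [Int.cast_pow, Int.cast_pow, Int.cast_natCast] at h
    exact h
  have hc₂ : countZeta (fun s => ((-(Nat.card k : ℤ) ^ (l + 1)) ^ m) ^ s) *
      ((1 - C ((-((Nat.card k : ℚ) ^ (l + 1))) ^ m) * X : ℚ[X]) : PowerSeries ℚ) = 1 := by
    have h := hc ((-(Nat.card k : ℤ) ^ (l + 1)) ^ m)
    rw [Int.cast_pow, Int.cast_neg, Int.cast_pow, Int.cast_natCast] at h
    exact h
  rw [hZ, mul_mul_mul_comm, ← Finset.prod_mul_distrib, Finset.prod_eq_one fun i _ => hc₁ i, one_mul, hc₂]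

/-- **`m` even: `Z(ℰ ⊗ 𝔽_{q^m}, T) · ∏ᵢ(1 − (q^m)ⁱT) · (1 − (q^m)^{l+1}T) = 1`** — over an even-degree extension the
elliptic quadric has the zeta function of the hyperbolic one (the factor `1 − (q^m)^{l+1}T` appears TWICE).
[cite: Hirschfeld1998, §5.2 Thm. 5.2.6 (ii)] [cite: Stichtenoth2009, Theorem 5.1.15 (f)] -/
theorem zetaSeriesPow_ellipticQuadric_mul_prod_of_even (hε : ¬IsSquare ε) {m : ℕ} (hm : 0 < m) (heven : Even m) :
    zetaSeriesPow
        (hypersurface ((∑ i : Fin (l + 1), MvPolynomial.X (Fin.castLE (leE l) i) *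
          MvPolynomial.X (Fin.rev (Fin.castLE (leE l) i))) + MvPolynomial.X (Fin.mk (l + 1) (ltE₁ l)) ^ 2 -
          MvPolynomial.C ε * MvPolynomial.X (Fin.mk (l + 2) (ltE₂ l)) ^ 2 : MvPolynomial (Fin (2 * l + 2 + 2)) k)) m *
      ((∏ i ∈ range (2 * l + 3), ((1 - C (((Nat.card k : ℚ) ^ m) ^ i) * X : ℚ[X]) : PowerSeries ℚ)) *
        ((1 - C (((Nat.card k : ℚ) ^ m) ^ (l + 1)) * X : ℚ[X]) : PowerSeries ℚ)) = 1 := by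
  have h := zetaSeriesPow_ellipticQuadric_mul_prod l hε hm
  rwa [heven.neg_pow, ← pow_mul, mul_comm (l + 1) m, pow_mul] at h

/-- **`m` odd: `Z(ℰ ⊗ 𝔽_{q^m}, T) · ∏ᵢ(1 − (q^m)ⁱT) · (1 + (q^m)^{l+1}T) = 1`** — over an odd-degree extension `ε` stays a
non-square and the quadric stays elliptic (inverse root `−(q^m)^{l+1}`). [cite: Hirschfeld1998, §5.2 Thm. 5.2.6 (iii)]
[cite: LidlNiederreiter1996, Thm. 2.6] [cite: Stichtenoth2009, Theorem 5.1.15 (f)] -/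
theorem zetaSeriesPow_ellipticQuadric_mul_prod_of_odd (hε : ¬IsSquare ε) {m : ℕ} (hodd : Odd m) :
    zetaSeriesPow
        (hypersurface ((∑ i : Fin (l + 1), MvPolynomial.X (Fin.castLE (leE l) i) *
          MvPolynomial.X (Fin.rev (Fin.castLE (leE l) i))) + MvPolynomial.X (Fin.mk (l + 1) (ltE₁ l)) ^ 2 -
          MvPolynomial.C ε * MvPolynomial.X (Fin.mk (l + 2) (ltE₂ l)) ^ 2 : MvPolynomial (Fin (2 * l + 2 + 2)) k)) m *
      ((∏ i ∈ range (2 * l + 3), ((1 - C (((Nat.card k : ℚ) ^ m) ^ i) * X : ℚ[X]) : PowerSeries ℚ)) *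
        ((1 + C (((Nat.card k : ℚ) ^ m) ^ (l + 1)) * X : ℚ[X]) : PowerSeries ℚ)) = 1 := by
  have h := zetaSeriesPow_ellipticQuadric_mul_prod l hε hodd.pos
  rwa [hodd.neg_pow, ← pow_mul, mul_comm (l + 1) m, pow_mul, map_neg, neg_mul, sub_neg_eq_add] at h

/-- **`m` even: the middle pole of `Z(ℰ ⊗ 𝔽_{q^m}, T)` at `T = (q^m)^{−(l+1)}` has order EXACTLY `2`** (both rulings
are rational over `𝔽_{q^m}`; Tate 1965 §3: the rank of the `(l+1)`-cycles over `𝔽_{q^m}` is `2`).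
[cite: TateWoodsHole1965, §3] [cite: Kahn2020, §3.6 Remark 3.66 and §6.14 Conj. 6.52] -/
theorem hasPoleOfOrderAt_zetaSeriesPow_ellipticQuadric_middle_of_even (hε : ¬IsSquare ε) {m : ℕ} (hm : 0 < m)
    (heven : Even m) :
    HasPoleOfOrderAt (zetaSeriesPow
        (hypersurface ((∑ i : Fin (l + 1), MvPolynomial.X (Fin.castLE (leE l) i) *
          MvPolynomial.X (Fin.rev (Fin.castLE (leE l) i))) + MvPolynomial.X (Fin.mk (l + 1) (ltE₁ l)) ^ 2 -
          MvPolynomial.C ε * MvPolynomial.X (Fin.mk (l + 2) (ltE₂ l)) ^ 2 : MvPolynomial (Fin (2 * l + 2 + 2)) k)) m)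
      ((((Nat.card k : ℚ) ^ m) ^ (l + 1))⁻¹) 2 := by
  have hZ := zetaSeriesPow_ellipticQuadric_mul_prod_of_even l hε hm heven
  have hqm : 1 < Nat.card k ^ m := Nat.one_lt_pow hm.ne' Finite.one_lt_card
  -- the product as `∏ (1 − (q^m)ⁱT)^{cᵢ}`, `c_{l+1} = 2`
  have hprod : (∏ i ∈ Finset.range (2 * l + 3), ((1 - C (((Nat.card k : ℚ) ^ m) ^ i) * X : ℚ[X]) : PowerSeries ℚ)) *
      ((1 - C (((Nat.card k : ℚ) ^ m) ^ (l + 1)) * X : ℚ[X]) : PowerSeries ℚ) =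
      ((∏ i ∈ Finset.range (2 * l + 3), (1 - C ((((Nat.card k ^ m : ℕ) : ℚ)) ^ i) * X) ^
        (if i = l + 1 then 2 else 1) : ℚ[X]) : PowerSeries ℚ) := by
    have hpoly : (∏ i ∈ Finset.range (2 * l + 3), (1 - C ((((Nat.card k ^ m : ℕ) : ℚ)) ^ i) * X) ^
        (if i = l + 1 then 2 else 1) : ℚ[X]) =
        (∏ i ∈ Finset.range (2 * l + 3), (1 - C (((Nat.card k : ℚ) ^ m) ^ i) * X)) *
          (1 - C (((Nat.card k : ℚ) ^ m) ^ (l + 1)) * X) := by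
      rw [Nat.cast_pow, Finset.prod_congr rfl (fun i _ => (by
          split_ifs with h
          · rw [h, pow_two]
          · rw [pow_one, mul_one]) :
          ∀ i ∈ Finset.range (2 * l + 3), ((1 - C (((Nat.card k : ℚ) ^ m) ^ i) * X) ^ (if i = l + 1 then 2 else 1) :
            ℚ[X]) = (1 - C (((Nat.card k : ℚ) ^ m) ^ i) * X) *
              (if i = l + 1 then (1 - C (((Nat.card k : ℚ) ^ m) ^ (l + 1)) * X) else 1)),
        Finset.prod_mul_distrib, Finset.prod_ite_eq', if_pos (Finset.mem_range.mpr (by omega))]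
    rw [hpoly, Polynomial.coe_mul]
    congr 1
    symm
    rw [← Polynomial.coeToPowerSeries.ringHom_apply, map_prod]
    exact Finset.prod_congr rfl fun i _ => by rw [Polynomial.coeToPowerSeries.ringHom_apply]
  rw [hprod] at hZ
  have h := hasPoleOfOrderAt_of_mul_prod_pow_eq_one (Finset.range (2 * l + 3)) (fun i => i)
    (fun i => if i = l + 1 then 2 else 1) hqm (l + 1) hZ
  simp only [Finset.filter_eq', Finset.mem_range, show l + 1 < 2 * l + 3 by omega, if_true,
    Finset.sum_singleton, Nat.cast_pow] at h
  exact h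

/-- **`m` odd: the middle pole of `Z(ℰ ⊗ 𝔽_{q^m}, T)` at `T = (q^m)^{−(l+1)}` stays SIMPLE** (the factor
`1 + (q^m)^{l+1}T` does not vanish there). [cite: TateWoodsHole1965, §3] [cite: Kahn2020, §6.14 Conj. 6.52] -/
theorem hasPoleOfOrderAt_zetaSeriesPow_ellipticQuadric_middle_of_odd (hε : ¬IsSquare ε) {m : ℕ} (hodd : Odd m) :
    HasPoleOfOrderAt (zetaSeriesPow
        (hypersurface ((∑ i : Fin (l + 1), MvPolynomial.X (Fin.castLE (leE l) i) *
          MvPolynomial.X (Fin.rev (Fin.castLE (leE l) i))) + MvPolynomial.X (Fin.mk (l + 1) (ltE₁ l)) ^ 2 -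
          MvPolynomial.C ε * MvPolynomial.X (Fin.mk (l + 2) (ltE₂ l)) ^ 2 : MvPolynomial (Fin (2 * l + 2 + 2)) k)) m)
      ((((Nat.card k : ℚ) ^ m) ^ (l + 1))⁻¹) 1 := by
  have hZ := zetaSeriesPow_ellipticQuadric_mul_prod_of_odd l hε hodd
  have hqm : 1 < Nat.card k ^ m := Nat.one_lt_pow hodd.pos.ne' Finite.one_lt_card
  have hprod : (∏ i ∈ Finset.range (2 * l + 3), ((1 - C (((Nat.card k : ℚ) ^ m) ^ i) * X : ℚ[X]) : PowerSeries ℚ)) =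
      ((∏ i ∈ Finset.range (2 * l + 3), (1 - C ((((Nat.card k ^ m : ℕ) : ℚ)) ^ i) * X) ^ 1 : ℚ[X]) :
        PowerSeries ℚ) := by
    rw [← Polynomial.coeToPowerSeries.ringHom_apply, map_prod]
    refine Finset.prod_congr rfl fun i _ => ?_
    rw [Polynomial.coeToPowerSeries.ringHom_apply, pow_one, Nat.cast_pow]
  have hT : zetaSeriesPow
        (hypersurface ((∑ i : Fin (l + 1), MvPolynomial.X (Fin.castLE (leE l) i) *
          MvPolynomial.X (Fin.rev (Fin.castLE (leE l) i))) + MvPolynomial.X (Fin.mk (l + 1) (ltE₁ l)) ^ 2 -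
          MvPolynomial.C ε * MvPolynomial.X (Fin.mk (l + 2) (ltE₂ l)) ^ 2 : MvPolynomial (Fin (2 * l + 2 + 2)) k)) m *
      ((1 + C (((Nat.card k : ℚ) ^ m) ^ (l + 1)) * X : ℚ[X]) : PowerSeries ℚ) *
      ((∏ i ∈ Finset.range (2 * l + 3), (1 - C ((((Nat.card k ^ m : ℕ) : ℚ)) ^ i) * X) ^ 1 : ℚ[X]) :
        PowerSeries ℚ) = 1 := by
    rw [← hprod, mul_assoc, mul_comm (((1 + C (((Nat.card k : ℚ) ^ m) ^ (l + 1)) * X : ℚ[X]) : PowerSeries ℚ)), hZ]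
  have h := hasPoleOfOrderAt_of_mul_prod_pow_eq_one (Finset.range (2 * l + 3)) (fun i => i) (fun _ => 1) hqm (l + 1) hT
  simp only [Finset.sum_const, smul_eq_mul, mul_one, Finset.filter_eq', Finset.mem_range,
    show l + 1 < 2 * l + 3 by omega, if_true, Finset.card_singleton, Nat.cast_pow] at h
  refine h.of_mul_coe ?_
  rw [eval_add, eval_one, eval_mul, eval_C, eval_X]
  positivity

/-- **The parity law: `ord_{T=(q^m)^{−(l+1)}} Z(ℰ ⊗ 𝔽_{q^m}, T) = 2` if `m` is even, `1` if `m` is odd** — the rank of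
the middle-dimensional cycles of the elliptic quadric over `𝔽_{q^m}` (Tate 1965 §3). [cite: TateWoodsHole1965, §3]
[cite: Kahn2020, §3.6 Remark 3.66 and §6.14 Conj. 6.52] -/
theorem hasPoleOfOrderAt_zetaSeriesPow_ellipticQuadric_middle (hε : ¬IsSquare ε) {m : ℕ} (hm : 0 < m) :
    HasPoleOfOrderAt (zetaSeriesPow
        (hypersurface ((∑ i : Fin (l + 1), MvPolynomial.X (Fin.castLE (leE l) i) *
          MvPolynomial.X (Fin.rev (Fin.castLE (leE l) i))) + MvPolynomial.X (Fin.mk (l + 1) (ltE₁ l)) ^ 2 -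
          MvPolynomial.C ε * MvPolynomial.X (Fin.mk (l + 2) (ltE₂ l)) ^ 2 : MvPolynomial (Fin (2 * l + 2 + 2)) k)) m)
      ((((Nat.card k : ℚ) ^ m) ^ (l + 1))⁻¹) (if Even m then 2 else 1) := by
  split_ifs with h
  · exact hasPoleOfOrderAt_zetaSeriesPow_ellipticQuadric_middle_of_even l hε hm h
  · exact hasPoleOfOrderAt_zetaSeriesPow_ellipticQuadric_middle_of_odd l hε (Nat.not_even_iff_odd.mp h)

/-- Off the middle the poles of `Z(ℰ ⊗ 𝔽_{q^m}, T)` at `(q^m)^{−r}` are simple for every `m ≥ 1` (`r ≤ 2l+2`,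
`r ≠ l+1`). [cite: TateWoodsHole1965, §3] [cite: Weil1949, p. 507] -/
theorem hasPoleOfOrderAt_zetaSeriesPow_ellipticQuadric_of_ne (hε : ¬IsSquare ε) {m : ℕ} (hm : 0 < m) {r : ℕ}
    (hr : r ≤ 2 * l + 2) (hne : r ≠ l + 1) :
    HasPoleOfOrderAt (zetaSeriesPow
        (hypersurface ((∑ i : Fin (l + 1), MvPolynomial.X (Fin.castLE (leE l) i) *
          MvPolynomial.X (Fin.rev (Fin.castLE (leE l) i))) + MvPolynomial.X (Fin.mk (l + 1) (ltE₁ l)) ^ 2 -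
          MvPolynomial.C ε * MvPolynomial.X (Fin.mk (l + 2) (ltE₂ l)) ^ 2 : MvPolynomial (Fin (2 * l + 2 + 2)) k)) m)
      ((((Nat.card k : ℚ) ^ m) ^ r)⁻¹) 1 := by
  have hZ := zetaSeriesPow_ellipticQuadric_mul_prod l hε hm
  have hqm : 1 < Nat.card k ^ m := Nat.one_lt_pow hm.ne' Finite.one_lt_card
  have hprod : (∏ i ∈ Finset.range (2 * l + 3), ((1 - C (((Nat.card k : ℚ) ^ m) ^ i) * X : ℚ[X]) : PowerSeries ℚ)) =
      ((∏ i ∈ Finset.range (2 * l + 3), (1 - C ((((Nat.card k ^ m : ℕ) : ℚ)) ^ i) * X) ^ 1 : ℚ[X]) :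
        PowerSeries ℚ) := by
    rw [← Polynomial.coeToPowerSeries.ringHom_apply, map_prod]
    refine Finset.prod_congr rfl fun i _ => ?_
    rw [Polynomial.coeToPowerSeries.ringHom_apply, pow_one, Nat.cast_pow]
  have hT : zetaSeriesPow
        (hypersurface ((∑ i : Fin (l + 1), MvPolynomial.X (Fin.castLE (leE l) i) *
          MvPolynomial.X (Fin.rev (Fin.castLE (leE l) i))) + MvPolynomial.X (Fin.mk (l + 1) (ltE₁ l)) ^ 2 -
          MvPolynomial.C ε * MvPolynomial.X (Fin.mk (l + 2) (ltE₂ l)) ^ 2 : MvPolynomial (Fin (2 * l + 2 + 2)) k)) m *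
      ((1 - C ((-((Nat.card k : ℚ) ^ (l + 1))) ^ m) * X : ℚ[X]) : PowerSeries ℚ) *
      ((∏ i ∈ Finset.range (2 * l + 3), (1 - C ((((Nat.card k ^ m : ℕ) : ℚ)) ^ i) * X) ^ 1 : ℚ[X]) :
        PowerSeries ℚ) = 1 := by
    rw [← hprod, mul_assoc, mul_comm (((1 - C ((-((Nat.card k : ℚ) ^ (l + 1))) ^ m) * X : ℚ[X]) : PowerSeries ℚ)), hZ]
  have h := hasPoleOfOrderAt_of_mul_prod_pow_eq_one (Finset.range (2 * l + 3)) (fun i => i) (fun _ => 1) hqm r hT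
  simp only [Finset.sum_const, smul_eq_mul, mul_one, Finset.filter_eq', Finset.mem_range,
    show r < 2 * l + 3 by omega, if_true, Finset.card_singleton, Nat.cast_pow] at h
  refine h.of_mul_coe ?_
  -- `(−q^{l+1})^m (q^m)^{−r} ≠ 1`: its absolute value is `q^{m(l+1−r)} ≠ 1` unless `r = l+1`
  rw [eval_sub, eval_one, eval_mul, eval_C, eval_X, sub_ne_zero, ne_eq, eq_comm]
  intro h1
  have habs := congrArg abs h1
  rw [abs_mul, abs_pow, abs_neg, abs_pow, abs_inv, abs_pow, abs_pow, Nat.abs_cast, abs_one, ← pow_mul, ← pow_mul,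
    mul_comm (l + 1) m, mul_inv_eq_one₀ (pow_ne_zero _ (Nat.cast_ne_zero.mpr Nat.card_pos.ne'))] at habs
  have h'' : Nat.card k ^ (m * (l + 1)) = Nat.card k ^ (m * r) := by exact_mod_cast habs
  have hinj := Nat.pow_right_injective Finite.one_lt_card h''
  have : l + 1 = r := Nat.eq_of_mul_eq_mul_left hm hinj
  exact hne this.symm

end EFree

/-! ### §2 In cohomology: `φ_{l+1}(Fᵐ) = 1` for `m` even, `= φ_{l+1}` for `m` odd -/

namespace GaloisWeilCohomology

open SmoothHypersurface (hypersurface)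

variable {k : Type u} [Field k] [Finite k] {K : Type v} [Field K] [CharZero K]
  {χ : Field.absoluteGaloisGroup k →* Kˣ} (E : GaloisWeilCohomology k K χ) (l : ℕ) {ε : k}

/-- **`m` even: `φ_{l+1}(Fᵐ) = 1` on `H^{2l+2}(ℰ)(l+1)`** (`φ² = 1`, g52-#3): over `𝔽_{q^m}` every middle class of the
elliptic quadric is a Tate class. [cite: Kahn2020, §3.6 Remark 3.66] [cite: Tate1994, §1] -/
theorem ρTwist_pow_ellipticQuadric_middle_of_even (hE : E.HasLefschetzTraceFormula)
    (hχ : ((χ (arithFrob k) : Kˣ) : K) = Nat.card k) (hε : ¬IsSquare ε)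
    (hRH : E.WeilRiemannHypothesisFor
      (hypersurface ((∑ i : Fin (l + 1), MvPolynomial.X (Fin.castLE (leE l) i) *
          MvPolynomial.X (Fin.rev (Fin.castLE (leE l) i))) + MvPolynomial.X (Fin.mk (l + 1) (ltE₁ l)) ^ 2 -
          MvPolynomial.C ε * MvPolynomial.X (Fin.mk (l + 2) (ltE₂ l)) ^ 2 : MvPolynomial (Fin (2 * l + 2 + 2)) k)) (2 * l + 2)) {m : ℕ} (heven : Even m) :
    E.ρTwist
        (hypersurface ((∑ i : Fin (l + 1), MvPolynomial.X (Fin.castLE (leE l) i) *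
          MvPolynomial.X (Fin.rev (Fin.castLE (leE l) i))) + MvPolynomial.X (Fin.mk (l + 1) (ltE₁ l)) ^ 2 -
          MvPolynomial.C ε * MvPolynomial.X (Fin.mk (l + 2) (ltE₂ l)) ^ 2 : MvPolynomial (Fin (2 * l + 2 + 2)) k)) (2 * (l + 1)) (l + 1 : ℕ) (geomFrob k ^ m) = 1 := by
  obtain ⟨j, rfl⟩ := heven
  have hg : geomFrob k ^ (j + j) = (geomFrob k ^ 2) ^ j := by rw [← two_mul, pow_mul]
  rw [hg, map_pow, (E.ρTwist_geomFrob_sq_ellipticQuadric_middle l hE hχ hε hRH).1, one_pow]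

/-- **`m` odd: `φ_{l+1}(Fᵐ) = φ_{l+1}` on `H^{2l+2}(ℰ)(l+1)`** (`φ² = 1`): over an odd-degree extension the Galois action
on the middle cohomology is the same as over `𝔽_q`. [cite: Kahn2020, §3.6 Remark 3.66] [cite: Tate1994, §1] -/
theorem ρTwist_pow_ellipticQuadric_middle_of_odd (hE : E.HasLefschetzTraceFormula)
    (hχ : ((χ (arithFrob k) : Kˣ) : K) = Nat.card k) (hε : ¬IsSquare ε)
    (hRH : E.WeilRiemannHypothesisFor
      (hypersurface ((∑ i : Fin (l + 1), MvPolynomial.X (Fin.castLE (leE l) i) *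
          MvPolynomial.X (Fin.rev (Fin.castLE (leE l) i))) + MvPolynomial.X (Fin.mk (l + 1) (ltE₁ l)) ^ 2 -
          MvPolynomial.C ε * MvPolynomial.X (Fin.mk (l + 2) (ltE₂ l)) ^ 2 : MvPolynomial (Fin (2 * l + 2 + 2)) k)) (2 * l + 2)) {m : ℕ} (hodd : Odd m) :
    E.ρTwist
        (hypersurface ((∑ i : Fin (l + 1), MvPolynomial.X (Fin.castLE (leE l) i) *
          MvPolynomial.X (Fin.rev (Fin.castLE (leE l) i))) + MvPolynomial.X (Fin.mk (l + 1) (ltE₁ l)) ^ 2 -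
          MvPolynomial.C ε * MvPolynomial.X (Fin.mk (l + 2) (ltE₂ l)) ^ 2 : MvPolynomial (Fin (2 * l + 2 + 2)) k)) (2 * (l + 1)) (l + 1 : ℕ) (geomFrob k ^ m) =
      E.ρTwist
        (hypersurface ((∑ i : Fin (l + 1), MvPolynomial.X (Fin.castLE (leE l) i) *
          MvPolynomial.X (Fin.rev (Fin.castLE (leE l) i))) + MvPolynomial.X (Fin.mk (l + 1) (ltE₁ l)) ^ 2 -
          MvPolynomial.C ε * MvPolynomial.X (Fin.mk (l + 2) (ltE₂ l)) ^ 2 : MvPolynomial (Fin (2 * l + 2 + 2)) k)) (2 * (l + 1)) (l + 1 : ℕ) (geomFrob k) := by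
  obtain ⟨j, rfl⟩ := hodd
  have hg : geomFrob k ^ (2 * j + 1) = (geomFrob k ^ 2) ^ j * geomFrob k := by rw [pow_succ, pow_mul]
  rw [hg, map_mul, map_pow, (E.ρTwist_geomFrob_sq_ellipticQuadric_middle l hE hχ hε hRH).1, one_pow, one_mul]

/-- **`m` even: `Ker(φ_{l+1}(Fᵐ) − 1) = H^{2l+2}(ℰ)(l+1)`** — over an even-degree extension every middle class is
Galois-fixed (both rulings are rational over `𝔽_{q^m}`). [cite: Kahn2020, §3.6 Remark 3.66] [cite: TateWoodsHole1965, §3] -/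
theorem ker_ρTwist_pow_sub_one_ellipticQuadric_middle_of_even (hE : E.HasLefschetzTraceFormula)
    (hχ : ((χ (arithFrob k) : Kˣ) : K) = Nat.card k) (hε : ¬IsSquare ε)
    (hRH : E.WeilRiemannHypothesisFor
      (hypersurface ((∑ i : Fin (l + 1), MvPolynomial.X (Fin.castLE (leE l) i) *
          MvPolynomial.X (Fin.rev (Fin.castLE (leE l) i))) + MvPolynomial.X (Fin.mk (l + 1) (ltE₁ l)) ^ 2 -
          MvPolynomial.C ε * MvPolynomial.X (Fin.mk (l + 2) (ltE₂ l)) ^ 2 : MvPolynomial (Fin (2 * l + 2 + 2)) k)) (2 * l + 2)) {m : ℕ} (heven : Even m) :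
    LinearMap.ker (E.ρTwist
        (hypersurface ((∑ i : Fin (l + 1), MvPolynomial.X (Fin.castLE (leE l) i) *
          MvPolynomial.X (Fin.rev (Fin.castLE (leE l) i))) + MvPolynomial.X (Fin.mk (l + 1) (ltE₁ l)) ^ 2 -
          MvPolynomial.C ε * MvPolynomial.X (Fin.mk (l + 2) (ltE₂ l)) ^ 2 : MvPolynomial (Fin (2 * l + 2 + 2)) k)) (2 * (l + 1)) (l + 1 : ℕ) (geomFrob k ^ m) - 1) = ⊤ := by
  rw [E.ρTwist_pow_ellipticQuadric_middle_of_even l hE hχ hε hRH heven, sub_self, LinearMap.ker_zero]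

/-- **`m` odd: `Ker(φ_{l+1}(Fᵐ) − 1) = K·η^{l+1}`** (`η` any hyperplane class) — over an odd-degree extension the only
Galois-fixed middle classes are the multiples of the linear-section class (g52-#2 for `m = 1`).
[cite: Kahn2020, §3.6 Remark 3.66] [cite: Tate1994, §1 Conjecture T^r] -/
theorem ker_ρTwist_pow_sub_one_ellipticQuadric_middle_of_odd (hE : E.HasLefschetzTraceFormula)
    (hχ : ((χ (arithFrob k) : Kˣ) : K) = Nat.card k) (hε : ¬IsSquare ε)
    (hRH : E.WeilRiemannHypothesisFor
      (hypersurface ((∑ i : Fin (l + 1), MvPolynomial.X (Fin.castLE (leE l) i) *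
          MvPolynomial.X (Fin.rev (Fin.castLE (leE l) i))) + MvPolynomial.X (Fin.mk (l + 1) (ltE₁ l)) ^ 2 -
          MvPolynomial.C ε * MvPolynomial.X (Fin.mk (l + 2) (ltE₂ l)) ^ 2 : MvPolynomial (Fin (2 * l + 2 + 2)) k)) (2 * l + 2)) {m : ℕ} (hodd : Odd m)
    {η : E.obj
      (hypersurface ((∑ i : Fin (l + 1), MvPolynomial.X (Fin.castLE (leE l) i) *
          MvPolynomial.X (Fin.rev (Fin.castLE (leE l) i))) + MvPolynomial.X (Fin.mk (l + 1) (ltE₁ l)) ^ 2 -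
          MvPolynomial.C ε * MvPolynomial.X (Fin.mk (l + 2) (ltE₂ l)) ^ 2 : MvPolynomial (Fin (2 * l + 2 + 2)) k)) 2}
    (hη : E.IsHyperplaneClass
      (hypersurface ((∑ i : Fin (l + 1), MvPolynomial.X (Fin.castLE (leE l) i) *
          MvPolynomial.X (Fin.rev (Fin.castLE (leE l) i))) + MvPolynomial.X (Fin.mk (l + 1) (ltE₁ l)) ^ 2 -
          MvPolynomial.C ε * MvPolynomial.X (Fin.mk (l + 2) (ltE₂ l)) ^ 2 : MvPolynomial (Fin (2 * l + 2 + 2)) k)) η) :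
    LinearMap.ker (E.ρTwist
        (hypersurface ((∑ i : Fin (l + 1), MvPolynomial.X (Fin.castLE (leE l) i) *
          MvPolynomial.X (Fin.rev (Fin.castLE (leE l) i))) + MvPolynomial.X (Fin.mk (l + 1) (ltE₁ l)) ^ 2 -
          MvPolynomial.C ε * MvPolynomial.X (Fin.mk (l + 2) (ltE₂ l)) ^ 2 : MvPolynomial (Fin (2 * l + 2 + 2)) k)) (2 * (l + 1)) (l + 1 : ℕ) (geomFrob k ^ m) - 1) =
      K ∙ E.pow
        (hypersurface ((∑ i : Fin (l + 1), MvPolynomial.X (Fin.castLE (leE l) i) *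
          MvPolynomial.X (Fin.rev (Fin.castLE (leE l) i))) + MvPolynomial.X (Fin.mk (l + 1) (ltE₁ l)) ^ 2 -
          MvPolynomial.C ε * MvPolynomial.X (Fin.mk (l + 2) (ltE₂ l)) ^ 2 : MvPolynomial (Fin (2 * l + 2 + 2)) k)) η (l + 1) := by
  rw [E.ρTwist_pow_ellipticQuadric_middle_of_odd l hE hχ hε hRH hodd]
  exact E.ker_sub_one_ellipticQuadric_eq_span_pow l hE hχ hε hRH (show l + 1 ≤ 2 * l + 2 by omega) hη

/-- **The second ruling is rational over `𝔽_{q^m}` exactly when `m` is even**: the Galois-fixed middle classes over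
`𝔽_{q^m}`, `Ker(φ_{l+1}(Fᵐ) − 1)`, are ALL of `H^{2l+2}(ℰ)(l+1)` for `m` even and the line `K·η^{l+1}` for `m` odd
(`η` any hyperplane class). [cite: Kahn2020, §3.6 Remark 3.66] [cite: TateWoodsHole1965, §3] [cite: Tate1994, §1 Conjecture T^r] -/
theorem ker_ρTwist_pow_sub_one_ellipticQuadric_middle (hE : E.HasLefschetzTraceFormula)
    (hχ : ((χ (arithFrob k) : Kˣ) : K) = Nat.card k) (hε : ¬IsSquare ε)
    (hRH : E.WeilRiemannHypothesisFor
      (hypersurface ((∑ i : Fin (l + 1), MvPolynomial.X (Fin.castLE (leE l) i) *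
          MvPolynomial.X (Fin.rev (Fin.castLE (leE l) i))) + MvPolynomial.X (Fin.mk (l + 1) (ltE₁ l)) ^ 2 -
          MvPolynomial.C ε * MvPolynomial.X (Fin.mk (l + 2) (ltE₂ l)) ^ 2 : MvPolynomial (Fin (2 * l + 2 + 2)) k)) (2 * l + 2)) (m : ℕ)
    {η : E.obj
      (hypersurface ((∑ i : Fin (l + 1), MvPolynomial.X (Fin.castLE (leE l) i) *
          MvPolynomial.X (Fin.rev (Fin.castLE (leE l) i))) + MvPolynomial.X (Fin.mk (l + 1) (ltE₁ l)) ^ 2 -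
          MvPolynomial.C ε * MvPolynomial.X (Fin.mk (l + 2) (ltE₂ l)) ^ 2 : MvPolynomial (Fin (2 * l + 2 + 2)) k)) 2}
    (hη : E.IsHyperplaneClass
      (hypersurface ((∑ i : Fin (l + 1), MvPolynomial.X (Fin.castLE (leE l) i) *
          MvPolynomial.X (Fin.rev (Fin.castLE (leE l) i))) + MvPolynomial.X (Fin.mk (l + 1) (ltE₁ l)) ^ 2 -
          MvPolynomial.C ε * MvPolynomial.X (Fin.mk (l + 2) (ltE₂ l)) ^ 2 : MvPolynomial (Fin (2 * l + 2 + 2)) k)) η) :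
    LinearMap.ker (E.ρTwist
        (hypersurface ((∑ i : Fin (l + 1), MvPolynomial.X (Fin.castLE (leE l) i) *
          MvPolynomial.X (Fin.rev (Fin.castLE (leE l) i))) + MvPolynomial.X (Fin.mk (l + 1) (ltE₁ l)) ^ 2 -
          MvPolynomial.C ε * MvPolynomial.X (Fin.mk (l + 2) (ltE₂ l)) ^ 2 : MvPolynomial (Fin (2 * l + 2 + 2)) k)) (2 * (l + 1)) (l + 1 : ℕ) (geomFrob k ^ m) - 1) =
      if Even m then ⊤ else K ∙ E.pow
        (hypersurface ((∑ i : Fin (l + 1), MvPolynomial.X (Fin.castLE (leE l) i) *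
          MvPolynomial.X (Fin.rev (Fin.castLE (leE l) i))) + MvPolynomial.X (Fin.mk (l + 1) (ltE₁ l)) ^ 2 -
          MvPolynomial.C ε * MvPolynomial.X (Fin.mk (l + 2) (ltE₂ l)) ^ 2 : MvPolynomial (Fin (2 * l + 2 + 2)) k)) η (l + 1) := by
  split_ifs with h
  · exact E.ker_ρTwist_pow_sub_one_ellipticQuadric_middle_of_even l hE hχ hε hRH h
  · exact E.ker_ρTwist_pow_sub_one_ellipticQuadric_middle_of_odd l hE hχ hε hRH (Nat.not_even_iff_odd.mp h) hη

/-- **`dim Ker(φ_{l+1}(Fᵐ) − 1) = 2` for `m` even, `= 1` for `m` odd** — the number of independent Tate classes of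
codimension `l+1` on `ℰ` over `𝔽_{q^m}`. [cite: TateWoodsHole1965, §3] [cite: Kahn2020, §3.6 Remark 3.66] -/
theorem finrank_ker_ρTwist_pow_sub_one_ellipticQuadric_middle (hE : E.HasLefschetzTraceFormula)
    (hχ : ((χ (arithFrob k) : Kˣ) : K) = Nat.card k) (hε : ¬IsSquare ε)
    (hRH : E.WeilRiemannHypothesisFor
      (hypersurface ((∑ i : Fin (l + 1), MvPolynomial.X (Fin.castLE (leE l) i) *
          MvPolynomial.X (Fin.rev (Fin.castLE (leE l) i))) + MvPolynomial.X (Fin.mk (l + 1) (ltE₁ l)) ^ 2 -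
          MvPolynomial.C ε * MvPolynomial.X (Fin.mk (l + 2) (ltE₂ l)) ^ 2 : MvPolynomial (Fin (2 * l + 2 + 2)) k)) (2 * l + 2)) (m : ℕ) :
    Module.finrank K (LinearMap.ker (E.ρTwist
        (hypersurface ((∑ i : Fin (l + 1), MvPolynomial.X (Fin.castLE (leE l) i) *
          MvPolynomial.X (Fin.rev (Fin.castLE (leE l) i))) + MvPolynomial.X (Fin.mk (l + 1) (ltE₁ l)) ^ 2 -
          MvPolynomial.C ε * MvPolynomial.X (Fin.mk (l + 2) (ltE₂ l)) ^ 2 : MvPolynomial (Fin (2 * l + 2 + 2)) k)) (2 * (l + 1)) (l + 1 : ℕ) (geomFrob k ^ m) - 1)) = if Even m then 2 else 1 := by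
  have hX := isSmoothProjective_ellipticQuadric_of_not_isSquare l hε
  haveI := E.finite_obj hX (2 * (l + 1))
  rcases Nat.even_or_odd m with h | h
  · rw [if_pos h, E.ker_ρTwist_pow_sub_one_ellipticQuadric_middle_of_even l hE hχ hε hRH h, finrank_top,
      E.finrank_ellipticQuadric_middle l hE hχ hε hRH]
  · obtain ⟨η, hη⟩ := E.isHyperplaneClass_nonempty hX (show 1 ≤ 2 * l + 2 by omega)
    rw [if_neg (Nat.not_even_iff_odd.mpr h), E.ker_ρTwist_pow_sub_one_ellipticQuadric_middle_of_odd l hE hχ hε hRH h hη]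
    exact finrank_span_singleton (E.pow_ne_zero_of_isHyperplaneClass hX hη (show l + 1 ≤ 2 * l + 2 by omega))

/-- **`dim H^{2l+2}(ℰ)(l+1)_{(φᵐ),1} = 2` for `m` even, `= 1` for `m` odd** — the order of the pole of
`Z(ℰ ⊗ 𝔽_{q^m}, T)` at `(q^m)^{−(l+1)}` (§1), read in `E` through the tree's `hasPoleOfOrderAt_zetaSeriesPow`.
[cite: Kahn2020, §6.14 Conj. 6.52] [cite: TateWoodsHole1965, §3] -/
theorem finrank_maxGenEigenspace_ρTwist_pow_ellipticQuadric_middle (hE : E.HasLefschetzTraceFormula)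
    (hχ : ((χ (arithFrob k) : Kˣ) : K) = Nat.card k) (hε : ¬IsSquare ε)
    (hRH : E.WeilRiemannHypothesisFor
      (hypersurface ((∑ i : Fin (l + 1), MvPolynomial.X (Fin.castLE (leE l) i) *
          MvPolynomial.X (Fin.rev (Fin.castLE (leE l) i))) + MvPolynomial.X (Fin.mk (l + 1) (ltE₁ l)) ^ 2 -
          MvPolynomial.C ε * MvPolynomial.X (Fin.mk (l + 2) (ltE₂ l)) ^ 2 : MvPolynomial (Fin (2 * l + 2 + 2)) k)) (2 * l + 2)) {m : ℕ} (hm : 0 < m) :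
    Module.finrank K (Module.End.maxGenEigenspace (E.ρTwist
        (hypersurface ((∑ i : Fin (l + 1), MvPolynomial.X (Fin.castLE (leE l) i) *
          MvPolynomial.X (Fin.rev (Fin.castLE (leE l) i))) + MvPolynomial.X (Fin.mk (l + 1) (ltE₁ l)) ^ 2 -
          MvPolynomial.C ε * MvPolynomial.X (Fin.mk (l + 2) (ltE₂ l)) ^ 2 : MvPolynomial (Fin (2 * l + 2 + 2)) k)) (2 * (l + 1)) (l + 1 : ℕ) (geomFrob k ^ m)) 1) = if Even m then 2 else 1 :=
  (E.hasPoleOfOrderAt_zetaSeriesPow hE hχ (isSmoothProjective_ellipticQuadric_of_not_isSquare l hε) hRH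
      (show l + 1 ≤ 2 * l + 2 by omega) hm).unique
    (hasPoleOfOrderAt_zetaSeriesPow_ellipticQuadric_middle l hε hm)

/-- **Off the middle, `φ_r(Fᵐ) = 1` on the line `H^{2r}(ℰ)`** (`r ≤ 2l+2`, `r ≠ l+1`, every `m`): `H^{2r}(ℰ) = K·ηʳ` is
fixed by `φ_r` (g52-#2 `ker_sub_one_ellipticQuadric_eq_span_pow` with `b_{2r} = 1`). [cite: Tate1994, §1] [cite: Weil1949, p. 507] -/
theorem ρTwist_pow_ellipticQuadric_eq_one_of_ne (hE : E.HasLefschetzTraceFormula)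
    (hχ : ((χ (arithFrob k) : Kˣ) : K) = Nat.card k) (hε : ¬IsSquare ε)
    (hRH : E.WeilRiemannHypothesisFor
      (hypersurface ((∑ i : Fin (l + 1), MvPolynomial.X (Fin.castLE (leE l) i) *
          MvPolynomial.X (Fin.rev (Fin.castLE (leE l) i))) + MvPolynomial.X (Fin.mk (l + 1) (ltE₁ l)) ^ 2 -
          MvPolynomial.C ε * MvPolynomial.X (Fin.mk (l + 2) (ltE₂ l)) ^ 2 : MvPolynomial (Fin (2 * l + 2 + 2)) k)) (2 * l + 2)) {r : ℕ} (hr : r ≤ 2 * l + 2) (hne : r ≠ l + 1) (m : ℕ) :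
    E.ρTwist
        (hypersurface ((∑ i : Fin (l + 1), MvPolynomial.X (Fin.castLE (leE l) i) *
          MvPolynomial.X (Fin.rev (Fin.castLE (leE l) i))) + MvPolynomial.X (Fin.mk (l + 1) (ltE₁ l)) ^ 2 -
          MvPolynomial.C ε * MvPolynomial.X (Fin.mk (l + 2) (ltE₂ l)) ^ 2 : MvPolynomial (Fin (2 * l + 2 + 2)) k)) (2 * r) r (geomFrob k ^ m) = 1 := by
  have hX := isSmoothProjective_ellipticQuadric_of_not_isSquare l hε
  haveI := E.finite_obj hX (2 * r)
  obtain ⟨η, hη⟩ := E.isHyperplaneClass_nonempty hX (show 1 ≤ 2 * l + 2 by omega)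
  -- `Ker(φ_r − 1) = K·ηʳ = H^{2r}(ℰ)` (dimension `1`)
  have hker : LinearMap.ker (E.ρTwist
      (hypersurface ((∑ i : Fin (l + 1), MvPolynomial.X (Fin.castLE (leE l) i) *
          MvPolynomial.X (Fin.rev (Fin.castLE (leE l) i))) + MvPolynomial.X (Fin.mk (l + 1) (ltE₁ l)) ^ 2 -
          MvPolynomial.C ε * MvPolynomial.X (Fin.mk (l + 2) (ltE₂ l)) ^ 2 : MvPolynomial (Fin (2 * l + 2 + 2)) k)) (2 * r) r (geomFrob k) - 1) = ⊤ := by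
    rw [E.ker_sub_one_ellipticQuadric_eq_span_pow l hE hχ hε hRH hr hη]
    refine Submodule.eq_top_of_finrank_eq ?_
    rw [finrank_span_singleton (E.pow_ne_zero_of_isHyperplaneClass hX hη hr),
      E.finrank_ellipticQuadric_two_mul_of_ne l hE hχ hε hRH hr hne]
  have hone : E.ρTwist
      (hypersurface ((∑ i : Fin (l + 1), MvPolynomial.X (Fin.castLE (leE l) i) *
          MvPolynomial.X (Fin.rev (Fin.castLE (leE l) i))) + MvPolynomial.X (Fin.mk (l + 1) (ltE₁ l)) ^ 2 -
          MvPolynomial.C ε * MvPolynomial.X (Fin.mk (l + 2) (ltE₂ l)) ^ 2 : MvPolynomial (Fin (2 * l + 2 + 2)) k)) (2 * r) r (geomFrob k) = 1 := by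
    rw [← sub_eq_zero, ← LinearMap.ker_eq_top]
    exact hker
  rw [map_pow, hone, one_pow]

end GaloisWeilCohomology

end Literature.AlgebraicGeometry.Motives

end
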